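import Literature.MathematicalPhysics.QuantumLattice.HubbardOpenBoxEDUpperCertificate
import Literature.Computation.Certificates.PackedGramCertificate
import HarnessLib

/-!
# Packed sector rows of the open-cluster `t–t'` Hubbard Hamiltonian (checked code lists, rank
# tables, one big-integer row per configuration)

Topic `MathematicalPhysics/QuantumLattice`, family `hubbard`. Infrastructure for KERNEL-CHECKED
exact-diagonalisation certificates of open clusters whose spin sectors are too large for the
entry-by-entry checker `OccupationCode.SectorCert` (`HubbardOpenBoxEDCertificate`: `n²` evaluations of
the 72-term coded entry function, `≈ 8·10⁶` kernel steps per sector of size `n = 400`). Here the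
sector block is produced ROW BY ROW as ONE big integer per configuration, through the tree's coded
application of the cluster Hamiltonian to a coded vector
(`HubbardOpenBoxEDUpperCertificate.hubbardOpenBoxTT'_mulVec_code`, Lin–Gubernatis 1993 §II):
applying `H` to the vector `m ↦ Y^{rank m}` (`Y = 2^y`, `rank` = position of the code in the sector
list) gives `Σ_j H_{ij} Y^j`, i.e. the packed row `i` (Kronecker substitution / evaluation at a power
of two, Harvey 2009 §3.1), whose entries are then read by one shift and one `mod` each
(`PSD.Packed.entry`, `PSD.Packed.digit_of_expansion` of `PackedGramCertificate`).

* §1 CHECKED SECTOR CODE LISTS. The certificate supplies the code list `L` of the spin sector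
  `(N↑, N↓) = (p, q)`; the kernel checks `sectorListOK`: strictly increasing, every code `< 4^{ab}`
  with bit counts `(p, q)`, and `|L| = C(ab, p)·C(ab, q)`. Since a spin sector has AT MOST
  `C(ab,p)·C(ab,q)` configurations (`card_sectorConfigs_le`, injection `s ↦ (upPart s, downPart s)`),
  such a list enumerates the sector exactly: `sum_sectorConfigs_eq_sum_fin_of_ok` transfers sector
  sums to sums over the positions of `L` (the role of `sum_sector_eq_sum_fin` for `sectorList`,
  whose evaluation — a filter over all `4^{ab}` codes — costs seconds of kernel time per sector).
* §2 the integer entry function `hzInt = −TN·hopNN − TD·hopDiag + UU·docc` (`= Q ·` the entry of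
  `H^open(TN/Q, TD/Q, UU/Q)`, `hubbardOpenBoxTT'_apply_eq_hzInt_div`), its SYMMETRY on configurations
  (`hzInt_code_symm`, from `hubbardOpenBoxTT'_isHermitian`) and the a-priori bound
  `|hzInt| ≤ (|TN| + |TD|)·2(ab)² + |UU|·ab` (`abs_hzInt_le`) that keeps packed digits from carrying.
* §3 RANK TABLES AND PACKED ROWS: `rankTab L` (`rank` of each code, 16-bit fields, checked by
  `rankOK`), `powF Y RT m = Y^{rank m}`, `rowH … m = (Q·H applied to powF)(m)` and
  **`rowH_eq_sum`**: `rowH … L[i] = Σ_j hzInt L[i] L[j] · Y^j`; the shifted, offset row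
  `rowA = K·rowH − K c·Y^i + O·Σ_j Y^j` and **`entry_rowA`**: its `j`-th `y`-bit field is
  `K·(hzInt L[i] L[j] − c·δ_ij)` (no carries as long as `K·(bound + |c|) < 2^{y-1}`).

Everything is proved; no named fact; nothing numerical is asserted here. Consumed by
`HubbardOpenBoxEDCertificateKronecker` (fixed-point Cholesky certificates with Kronecker-substitution
dot products).

## References

* H. Q. Lin, J. E. Gubernatis, Comput. Phys. 7 (1993) 400, §II (bit-coded sector bases addressed by
  position; Hamiltonian applied on the fly). [cite: LinGubernatis1993, §II]
* D. Harvey, J. Symb. Comput. 44 (2009) 1502, §3.1 (Kronecker substitution at `2^N`). [cite: Harvey2009, §3.1]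
* E. H. Lieb, PRL 62 (1989) 1201, proof of Thm 1 (configurations = pairs of up/down site sets).
  [cite: LiebPRL1989, proof of Theorem 1]
-/

namespace Literature.MathematicalPhysics.QuantumLattice

namespace OccupationCode

open Finset Matrix Literature.Computation.Certificates

/-! ### §1 Checked sector code lists -/

section SectorLists

variable {a b : ℕ}

/-- One code is a valid member of the spin sector `(p, q)` of `N` sites: `m < 4^N` and its even /
odd bit counts are `p` / `q`. [cite: LinGubernatis1993, §II] -/
def codeOK (N p q m : ℕ) : Bool :=
  decide (m < 4 ^ N) && decide (upCount N m = p) && decide (dnCount N m = q)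

/-- A strictly increasing list of valid codes of the sector `(p, q)` (structural walk).
[cite: LinGubernatis1993, §II] -/
def sectorCodesOK (N p q : ℕ) : List ℕ → Bool
  | [] => true
  | [m] => codeOK N p q m
  | m :: m' :: rest => codeOK N p q m && decide (m < m') && sectorCodesOK N p q (m' :: rest)

/-- **The kernel check of a supplied sector code list**: strictly increasing valid codes, and as many
of them as the sector can hold, `C(ab, p)·C(ab, q)`. [cite: LinGubernatis1993, §II] -/
def sectorListOK (a b p q : ℕ) (L : List ℕ) : Bool :=
  sectorCodesOK (a * b) p q L && decide (L.length = (a * b).choose p * (a * b).choose q)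

/-- Semantics of `sectorCodesOK`: validity of every member and strict monotonicity. [folklore] -/
private theorem sectorCodesOK_spec (N p q : ℕ) :
    ∀ L : List ℕ, sectorCodesOK N p q L = true →
      (∀ m ∈ L, m < 4 ^ N ∧ upCount N m = p ∧ dnCount N m = q) ∧ L.Pairwise (· < ·)
  | [], _ => by simp
  | [m], h => by
      simp only [sectorCodesOK, codeOK, Bool.and_eq_true, decide_eq_true_eq] at h
      refine ⟨fun x hx => ?_, List.pairwise_singleton _ _⟩
      rw [List.mem_singleton] at hx
      subst hx
      exact ⟨h.1.1, h.1.2, h.2⟩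
  | m :: m' :: rest, h => by
      simp only [sectorCodesOK, codeOK, Bool.and_eq_true, decide_eq_true_eq] at h
      obtain ⟨⟨hm, hlt⟩, hrest⟩ := h
      obtain ⟨hval, hpw⟩ := sectorCodesOK_spec N p q (m' :: rest) hrest
      refine ⟨?_, ?_⟩
      · intro x hx
        rcases List.mem_cons.1 hx with rfl | hx
        · exact ⟨hm.1.1, hm.1.2, hm.2⟩
        · exact hval x hx
      · rw [List.pairwise_cons]
        refine ⟨fun x hx => ?_, hpw⟩
        rcases List.mem_cons.1 hx with rfl | hx
        · exact hlt
        · exact lt_trans hlt (List.rel_of_pairwise_cons hpw hx)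

/-- **A spin sector of the open `a × b` box has at most `C(ab, p)·C(ab, q)` configurations**
(a configuration is determined by its up- and down-spin site sets). [cite: LiebPRL1989, proof of Theorem 1] -/
theorem card_sectorConfigs_le (a b p q : ℕ) :
    (sectorConfigs a b p q).card ≤ (a * b).choose p * (a * b).choose q := by
  classical
  let f : Finset (Orb (Fin a ×ₗ Fin b)) → Finset (Fin a ×ₗ Fin b) × Finset (Fin a ×ₗ Fin b) :=
    fun s => (upPart s, downPart s)
  have hmaps : Set.MapsTo f (sectorConfigs a b p q : Set (Finset (Orb (Fin a ×ₗ Fin b))))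
      ((univ.powersetCard p ×ˢ univ.powersetCard q : Finset (Finset (Fin a ×ₗ Fin b) × Finset (Fin a ×ₗ Fin b))) :
        Set (Finset (Fin a ×ₗ Fin b) × Finset (Fin a ×ₗ Fin b))) := by
    intro s hs
    have h1 := mem_sectorConfigs.1 (Finset.mem_coe.1 hs)
    simp only [f, Finset.coe_product, Set.mem_prod, Finset.mem_coe, Finset.mem_powersetCard]
    exact ⟨⟨Finset.subset_univ _, h1.1⟩, ⟨Finset.subset_univ _, h1.2⟩⟩
  have hinj : Set.InjOn f (sectorConfigs a b p q : Set (Finset (Orb (Fin a ×ₗ Fin b)))) := by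
    intro s _ s' _ h
    simp only [f, Prod.mk.injEq] at h
    rw [← pairSet_upPart_downPart s, ← pairSet_upPart_downPart s', h.1, h.2]
  have hcard := Finset.card_le_card_of_injOn f hmaps hinj
  rw [Finset.card_product, Finset.card_powersetCard, Finset.card_powersetCard, Finset.card_univ] at hcard
  have hΛ : Fintype.card (Fin a ×ₗ Fin b) = a * b := by simp [Fintype.card_prod, Lex]
  rwa [hΛ] at hcard

/-- A member of a checked list decodes to a configuration of the sector. [cite: LinGubernatis1993, §II] -/
theorem decode_mem_sectorConfigs_of_ok {p q : ℕ} {L : List ℕ} (h : sectorListOK a b p q L = true)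
    {m : ℕ} (hm : m ∈ L) : (decode m : Finset (Orb (Fin a ×ₗ Fin b))) ∈ sectorConfigs a b p q := by
  simp only [sectorListOK, Bool.and_eq_true, decide_eq_true_eq] at h
  obtain ⟨hm4, hu, hd⟩ := (sectorCodesOK_spec (a * b) p q L h.1).1 m hm
  rw [mem_sectorConfigs_iff_code_mem, code_decode hm4, mem_sectorList]
  exact ⟨hm4, hu, hd⟩

/-- Members of a checked list are codes (`< 4^{ab}`). [cite: LinGubernatis1993, §II] -/
theorem lt_of_mem_of_ok {p q : ℕ} {L : List ℕ} (h : sectorListOK a b p q L = true) {m : ℕ} (hm : m ∈ L) :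
    m < 4 ^ (a * b) := by
  simp only [sectorListOK, Bool.and_eq_true, decide_eq_true_eq] at h
  exact ((sectorCodesOK_spec (a * b) p q L h.1).1 m hm).1

/-- A checked list has no duplicates. [cite: LinGubernatis1993, §II] -/
theorem nodup_of_ok {p q : ℕ} {L : List ℕ} (h : sectorListOK a b p q L = true) : L.Nodup := by
  simp only [sectorListOK, Bool.and_eq_true, decide_eq_true_eq] at h
  exact (sectorCodesOK_spec (a * b) p q L h.1).2.imp fun {x y} hxy => ne_of_lt hxy

/-- **Transfer of sector sums to a checked code list**: if `sectorListOK a b p q L`, a sum over the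
configurations of the spin sector `(p, q)` is the sum, over the positions `i` of `L`, of the summand at
the decoded `i`-th code (the list enumerates the sector exactly, by the cardinality bound).
[cite: LinGubernatis1993, §II] -/
theorem sum_sectorConfigs_eq_sum_fin_of_ok {M : Type*} [AddCommMonoid M] {p q : ℕ} {L : List ℕ}
    (h : sectorListOK a b p q L = true) (F : Finset (Orb (Fin a ×ₗ Fin b)) → M) :
    ∑ s ∈ sectorConfigs a b p q, F s = ∑ i : Fin L.length, F (decode L[i]) := by
  classical
  have hnd := nodup_of_ok h
  have hlen : L.length = (a * b).choose p * (a * b).choose q := by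
    simp only [sectorListOK, Bool.and_eq_true, decide_eq_true_eq] at h
    exact h.2
  -- the image of the list under `decode` is the whole sector
  let T : Finset ℕ := L.toFinset
  have hTcard : T.card = L.length := List.toFinset_card_of_nodup hnd
  have hsub : T.image (fun m => (decode m : Finset (Orb (Fin a ×ₗ Fin b)))) ⊆ sectorConfigs a b p q := by
    intro s hs
    obtain ⟨m, hm, rfl⟩ := Finset.mem_image.1 hs
    exact decode_mem_sectorConfigs_of_ok h (List.mem_toFinset.1 hm)
  have hinj : Set.InjOn (fun m => (decode m : Finset (Orb (Fin a ×ₗ Fin b)))) (T : Set ℕ) := by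
    intro m hm m' hm' hmm
    have h1 := congrArg code hmm
    simp only at h1
    rwa [code_decode (lt_of_mem_of_ok h (List.mem_toFinset.1 (Finset.mem_coe.1 hm))),
      code_decode (lt_of_mem_of_ok h (List.mem_toFinset.1 (Finset.mem_coe.1 hm')))] at h1
  have himg_card : (T.image fun m => (decode m : Finset (Orb (Fin a ×ₗ Fin b)))).card = T.card :=
    Finset.card_image_of_injOn hinj
  have heq : T.image (fun m => (decode m : Finset (Orb (Fin a ×ₗ Fin b)))) = sectorConfigs a b p q := by
    refine Finset.eq_of_subset_of_card_le hsub ?_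
    rw [himg_card, hTcard, hlen]
    exact card_sectorConfigs_le a b p q
  rw [← heq, Finset.sum_image hinj]
  -- positions ↔ list elements
  rw [List.sum_toFinset _ hnd, ← List.sum_ofFn]
  congr 1
  exact (List.ofFn_getElem_eq_map L (fun m => F (decode m))).symm

/-- The `i`-th code of a checked list decodes to a configuration of the sector. [cite: LinGubernatis1993, §II] -/
theorem decode_getElem_mem_sectorConfigs_of_ok {p q : ℕ} {L : List ℕ} (h : sectorListOK a b p q L = true)
    (i : Fin L.length) : (decode L[i] : Finset (Orb (Fin a ×ₗ Fin b))) ∈ sectorConfigs a b p q :=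
  decode_mem_sectorConfigs_of_ok h (List.getElem_mem i.isLt)

end SectorLists

/-! ### §2 The integer entry function: dictionary, symmetry, a-priori bound -/

section Entry

variable {a b : ℕ}

/-- The integer entry function `hzInt = −TN·hopNN − TD·hopDiag + UU·docc` between two codes (`Q` times
the entry of `H^open(TN/Q, TD/Q, UU/Q)`). [cite: LinGubernatis1993, §II] -/
def hzInt (a b : ℕ) (TN TD UU : ℤ) (m m' : ℕ) : ℤ :=
  -TN * openBoxHopNN a b m m' - TD * openBoxHopDiag a b m m' + UU * doccCode a b m m'

/-- The dictionary at integer couplings: `H^open(TN, TD, UU) s s' = hzInt (code s) (code s')`.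
[cite: LinGubernatis1993, §II] -/
theorem hubbardOpenBoxTT'_apply_eq_hzInt (TN TD UU : ℤ) (s s' : Finset (Orb (Fin a ×ₗ Fin b))) :
    hubbardOpenBoxTT' a b (TN : ℝ) (TD : ℝ) (UU : ℝ) s s' =
      ((hzInt a b TN TD UU (code s) (code s') : ℝ) : ℂ) := by
  rw [hubbardOpenBoxTT'_apply_eq_code, hzInt]
  push_cast
  ring

/-- The dictionary at rational couplings: `H^open(TN/Q, TD/Q, UU/Q) s s' = hzInt (code s) (code s') / Q`.
[cite: LinGubernatis1993, §II] -/
theorem hubbardOpenBoxTT'_apply_eq_hzInt_div (TN TD UU : ℤ) {Q : ℕ} (hQ : 0 < Q)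
    (s s' : Finset (Orb (Fin a ×ₗ Fin b))) :
    hubbardOpenBoxTT' a b ((TN : ℝ) / Q) ((TD : ℝ) / Q) ((UU : ℝ) / Q) s s' =
      ((hzInt a b TN TD UU (code s) (code s') : ℝ) : ℂ) / ((Q : ℝ) : ℂ) := by
  rw [hubbardOpenBoxTT'_apply_eq_code, hzInt]
  have hQ' : (Q : ℂ) ≠ 0 := by exact_mod_cast hQ.ne'
  push_cast
  field_simp

/-- **Symmetry** of the integer block on configurations: `hzInt (code s) (code s') = hzInt (code s') (code s)`
(the cluster Hamiltonian is Hermitian with real entries). [cite: LinGubernatis1993, §II] -/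
theorem hzInt_code_symm (TN TD UU : ℤ) (s s' : Finset (Orb (Fin a ×ₗ Fin b))) :
    hzInt a b TN TD UU (code s) (code s') = hzInt a b TN TD UU (code s') (code s) := by
  have hH := (hubbardOpenBoxTT'_isHermitian a b (TN : ℝ) (TD : ℝ) (UU : ℝ)).apply s s'
  rw [hubbardOpenBoxTT'_apply_eq_hzInt, hubbardOpenBoxTT'_apply_eq_hzInt, RCLike.star_def,
    Complex.conj_ofReal] at hH
  exact_mod_cast hH.symm

/-- Structural sums of bounded integers are bounded. [folklore] -/
private theorem abs_sumNat_le (f : ℕ → ℤ) (c : ℤ) (hf : ∀ i, |f i| ≤ c) : ∀ n : ℕ, |sumNat f n| ≤ n * c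
  | 0 => by simp [sumNat]
  | n + 1 => by
      rw [sumNat]
      calc |sumNat f n + f n| ≤ |sumNat f n| + |f n| := abs_add_le _ _
        _ ≤ n * c + c := add_le_add (abs_sumNat_le f c hf n) (hf n)
        _ = (n + 1 : ℕ) * c := by push_cast; ring

/-- `|hopCode| ≤ 1`. [cite: LinGubernatis1993, §II] -/
private theorem abs_hopCode_le (p q m n : ℕ) : |hopCode p q m n| ≤ 1 := by
  unfold hopCode
  split_ifs
  · simp
  · simp

/-- `|openBoxHop adj N m m'| ≤ 2N²`. [cite: LinGubernatis1993, §II] -/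
private theorem abs_openBoxHop_le (adj : ℕ → ℕ → Bool) (N m m' : ℕ) :
    |openBoxHop adj N m m'| ≤ (N : ℤ) * (N * 2) := by
  unfold openBoxHop
  refine abs_sumNat_le _ _ (fun P => ?_) N
  refine abs_sumNat_le _ _ (fun Q => ?_) N
  split_ifs
  · have := abs_sumNat_le (fun σ => hopCode (2 * P + σ) (2 * Q + σ) m m') 1 (fun σ => abs_hopCode_le _ _ _ _) 2
    simpa using this
  · simp

/-- `|doccCode| ≤ N`. [cite: LinGubernatis1993, §II] -/
private theorem abs_doccCode_le (m m' : ℕ) : |doccCode a b m m'| ≤ (a * b : ℕ) := by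
  unfold doccCode
  split_ifs
  · have := abs_sumNat_le (fun P => if (m.testBit (2 * P) && m.testBit (2 * P + 1)) = true then (1 : ℤ) else 0) 1
      (fun P => by split_ifs <;> simp) (a * b)
    simpa using this
  · simp only [abs_zero]
    exact_mod_cast Nat.zero_le _

/-- The a-priori bound used against digit overflow: `|hzInt| ≤ (|TN| + |TD|)·2(ab)² + |UU|·ab`.
[cite: LinGubernatis1993, §II] -/
def hzBound (N : ℕ) (TN TD UU : ℤ) : ℕ :=
  (TN.natAbs + TD.natAbs) * (2 * N * N) + UU.natAbs * N

/-- `|hzInt a b TN TD UU m m'| ≤ hzBound (ab) TN TD UU`. [cite: LinGubernatis1993, §II] -/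
theorem abs_hzInt_le (TN TD UU : ℤ) (m m' : ℕ) :
    |hzInt a b TN TD UU m m'| ≤ (hzBound (a * b) TN TD UU : ℤ) := by
  have h1 : |openBoxHopNN a b m m'| ≤ ((a * b : ℕ) : ℤ) * (((a * b : ℕ) : ℤ) * 2) :=
    abs_openBoxHop_le (nnAdjCode b) (a * b) m m'
  have h2 : |openBoxHopDiag a b m m'| ≤ ((a * b : ℕ) : ℤ) * (((a * b : ℕ) : ℤ) * 2) :=
    abs_openBoxHop_le (diagAdjCode b) (a * b) m m'
  have h3 : |doccCode a b m m'| ≤ ((a * b : ℕ) : ℤ) := abs_doccCode_le m m'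
  have e : (hzBound (a * b) TN TD UU : ℤ) =
      (|TN| + |TD|) * (2 * ((a * b : ℕ) : ℤ) * ((a * b : ℕ) : ℤ)) + |UU| * ((a * b : ℕ) : ℤ) := by
    simp only [hzBound, Nat.cast_add, Nat.cast_mul, Nat.cast_ofNat, Int.natCast_natAbs]
  refine le_of_le_of_eq ?_ e.symm
  unfold hzInt
  set X := openBoxHopNN a b m m' with hX
  set W := openBoxHopDiag a b m m' with hW
  set Z := doccCode a b m m' with hZ
  have t1 : |-TN * X - TD * W + UU * Z| ≤ |-TN * X - TD * W| + |UU * Z| := abs_add_le _ _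
  have t2 : |-TN * X - TD * W| ≤ |-TN * X| + |TD * W| := abs_sub _ _
  have t3 : |-TN * X| = |TN| * |X| := by rw [abs_mul, abs_neg]
  have t4 : |TD * W| = |TD| * |W| := abs_mul _ _
  have t5 : |UU * Z| = |UU| * |Z| := abs_mul _ _
  have u1 : |TN| * |X| ≤ |TN| * (((a * b : ℕ) : ℤ) * (((a * b : ℕ) : ℤ) * 2)) :=
    mul_le_mul_of_nonneg_left h1 (abs_nonneg _)
  have u2 : |TD| * |W| ≤ |TD| * (((a * b : ℕ) : ℤ) * (((a * b : ℕ) : ℤ) * 2)) :=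
    mul_le_mul_of_nonneg_left h2 (abs_nonneg _)
  have u3 : |UU| * |Z| ≤ |UU| * ((a * b : ℕ) : ℤ) := mul_le_mul_of_nonneg_left h3 (abs_nonneg _)
  have e2 : (|TN| + |TD|) * (2 * ((a * b : ℕ) : ℤ) * ((a * b : ℕ) : ℤ)) + |UU| * ((a * b : ℕ) : ℤ) =
      |TN| * (((a * b : ℕ) : ℤ) * (((a * b : ℕ) : ℤ) * 2)) + |TD| * (((a * b : ℕ) : ℤ) * (((a * b : ℕ) : ℤ) * 2))
        + |UU| * ((a * b : ℕ) : ℤ) := by ring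
  rw [e2]
  linarith

end Entry

/-! ### §3 Rank tables and packed rows -/

section Rows

variable {a b : ℕ}

/-- The rank table of a code list: 16-bit field number `m` holds the position of the code `m`
(positions from `j₀`). [cite: LinGubernatis1993, §II] -/
def rankTab : List ℕ → ℕ → ℕ
  | [], _ => 0
  | m :: rest, j => (j <<< (16 * m)) + rankTab rest (j + 1)

/-- Position of the code `m` read from a rank table. [cite: LinGubernatis1993, §II] -/
def rankOf (RT m : ℕ) : ℕ := (RT >>> (16 * m)) % 2 ^ 16

/-- The kernel check of a rank table against the list: field `L[j]` holds `j` (from `j₀`). [folklore] -/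
def rankOK (RT : ℕ) : List ℕ → ℕ → Bool
  | [], _ => true
  | m :: rest, j => (rankOf RT m == j) && rankOK RT rest (j + 1)

/-- Semantics of `rankOK`. [folklore] -/
private theorem rankOK_spec (RT : ℕ) : ∀ (L : List ℕ) (j₀ : ℕ), rankOK RT L j₀ = true →
    ∀ (i : ℕ) (hi : i < L.length), rankOf RT L[i] = j₀ + i
  | [], _, _, i, hi => absurd hi (Nat.not_lt_zero i)
  | m :: rest, j₀, h, i, hi => by
      simp only [rankOK, Bool.and_eq_true, beq_iff_eq] at h
      cases i with
      | zero => simpa using h.1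
      | succ i =>
          have := rankOK_spec RT rest (j₀ + 1) h.2 i (by simpa using hi)
          simp only [List.getElem_cons_succ]
          omega

/-- `rankOf` at the positions of a checked table (`Fin`-indexed form): the position of a code is read back from
the table. [cite: LinGubernatis1993, §II] -/
theorem rankOf_getElem {RT : ℕ} {L : List ℕ} (h : rankOK RT L 0 = true) (j : Fin L.length) :
    rankOf RT L[j] = (j : ℕ) := by
  have := rankOK_spec RT L 0 h j j.isLt
  simpa [Fin.getElem_fin] using this

/-- The coded vector `m ↦ Y^{rank m}` (as an integer function; evaluation point of the packed rows).
[cite: Harvey2009, §3.1] -/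
def powF (Y RT : ℕ) (m : ℕ) : ℤ := ((Y ^ rankOf RT m : ℕ) : ℤ)

/-- **The packed row**: `Q·H^open` applied to `m ↦ Y^{rank m}` at the code `m`, in integer arithmetic
(`hubbardOpenBoxTT'_mulVec_code` with integer couplings). [cite: LinGubernatis1993, §II] -/
def rowH (a b : ℕ) (TN TD UU : ℤ) (Y RT m : ℕ) : ℤ :=
  -TN * openBoxHopApply (nnAdjCode b) (a * b) m (powF Y RT)
    - TD * openBoxHopApply (diagAdjCode b) (a * b) m (powF Y RT)
    + UU * (doccOf (a * b) m * powF Y RT m)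

/-- **The packed row is the row**: for a checked sector list `L` with its rank table,
`rowH … L[i] = Σ_j hzInt L[i] L[j] · Y^j` (`H` preserves the spin sector, so `H e_i` is supported on
`L`; the sector sum is transferred to the positions of `L`). [cite: LinGubernatis1993, §II] [cite: Harvey2009, §3.1] -/
theorem rowH_eq_sum {p q : ℕ} {L : List ℕ} (hL : sectorListOK a b p q L = true) (TN TD UU : ℤ)
    {Y RT : ℕ} (hRT : rankOK RT L 0 = true) (i : Fin L.length) :
    rowH a b TN TD UU Y RT L[i] = ∑ j : Fin L.length, hzInt a b TN TD UU L[i] L[j] * (Y : ℤ) ^ (j : ℕ) := by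
  set s : Finset (Orb (Fin a ×ₗ Fin b)) := decode L[i] with hs
  have hcode : code s = L[i] := code_decode (lt_of_mem_of_ok hL (List.getElem_mem i.isLt))
  have hsec : s ∈ sectorConfigs a b p q := decode_getElem_mem_sectorConfigs_of_ok hL i
  -- the dictionary: `(H φ)(s) = rowH` with integer couplings
  have hmul := hubbardOpenBoxTT'_mulVec_code a b (TN : ℝ) (TD : ℝ) (UU : ℝ) (powF Y RT) s
  rw [hcode] at hmul
  have hR : ((-(TN : ℝ) * openBoxHopApply (nnAdjCode b) (a * b) L[i] (powF Y RT)
      - (TD : ℝ) * openBoxHopApply (diagAdjCode b) (a * b) L[i] (powF Y RT)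
      + (UU : ℝ) * (doccOf (a * b) L[i] * powF Y RT L[i]) : ℝ) : ℂ) =
      ((rowH a b TN TD UU Y RT L[i] : ℝ) : ℂ) := by
    rw [rowH]; push_cast; ring
  rw [hR] at hmul
  -- the matrix side: restrict the sum to the sector, then transfer to the list
  have hmv : (hubbardOpenBoxTT' a b (TN : ℝ) (TD : ℝ) (UU : ℝ) *ᵥ codedVec (powF Y RT)) s =
      ∑ j : Fin L.length, ((hzInt a b TN TD UU L[i] L[j] * (Y : ℤ) ^ (j : ℕ) : ℤ) : ℂ) := by
    rw [mulVec, dotProduct]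
    have hzero : ∀ s' : Finset (Orb (Fin a ×ₗ Fin b)), s' ∉ sectorConfigs a b p q →
        hubbardOpenBoxTT' a b (TN : ℝ) (TD : ℝ) (UU : ℝ) s s' * codedVec (powF Y RT) s' = 0 := by
      intro s' hs'
      have h0 : hubbardOpenBoxTT' a b (TN : ℝ) (TD : ℝ) (UU : ℝ) s s' = 0 := by
        by_contra hne
        have hp := ThermodynamicLimit.preservesSectors_hubbardOpenBoxTT' a b (TN : ℝ) (TD : ℝ) (UU : ℝ) s s' hne
        have hs1 := mem_sectorConfigs.1 hsec
        exact hs' (mem_sectorConfigs.2 ⟨hp.1 ▸ hs1.1, hp.2 ▸ hs1.2⟩)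
      rw [h0, zero_mul]
    rw [← Finset.sum_subset (Finset.subset_univ (sectorConfigs a b p q)) (fun s' _ hs' => hzero s' hs'),
      sum_sectorConfigs_eq_sum_fin_of_ok hL]
    refine Finset.sum_congr rfl fun j _ => ?_
    have hcj : code (decode L[j] : Finset (Orb (Fin a ×ₗ Fin b))) = L[j] :=
      code_decode (lt_of_mem_of_ok hL (List.getElem_mem j.isLt))
    rw [hubbardOpenBoxTT'_apply_eq_hzInt, codedVec, hcode, hcj, powF, rankOf_getElem hRT j]
    push_cast
    ring
  rw [hmv] at hmul
  have h2 : ((∑ j : Fin L.length, hzInt a b TN TD UU L[i] L[j] * (Y : ℤ) ^ (j : ℕ) : ℤ) : ℂ) =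
      ((rowH a b TN TD UU Y RT L[i] : ℤ) : ℂ) := by
    rw [Int.cast_sum]; rw [hmul]; norm_cast
  exact_mod_cast h2.symm

/-- The offset packed row `i` of `K·(hzInt − c·1)`: `K·rowH − K c·Y^i + O·G` with `G = Σ_{j<n} Y^j`
(`O` the digit offset), as a natural number. [cite: Harvey2009, §3.1] -/
def rowA (a b : ℕ) (TN TD UU : ℤ) (K : ℕ) (c : ℤ) (Y O G RT m i : ℕ) : ℕ :=
  ((K : ℤ) * rowH a b TN TD UU Y RT m - (K : ℤ) * c * (Y : ℤ) ^ i + (O : ℤ) * (G : ℤ)).toNat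

/-- `Σ_{j<n} Y^j` by structural recursion. [folklore] -/
def geomNat (Y : ℕ) : ℕ → ℕ
  | 0 => 0
  | n + 1 => geomNat Y n + Y ^ n

/-- `geomNat Y n = Σ_{j<n} Y^j`. [folklore] -/
private theorem geomNat_eq (Y : ℕ) : ∀ n, geomNat Y n = ∑ j ∈ range n, Y ^ j
  | 0 => by simp [geomNat]
  | n + 1 => by rw [geomNat, geomNat_eq Y n, Finset.sum_range_succ]

/-- **The fields of the packed row are the shifted scaled entries**: with `Y = 2^y`, `O = 2^{y-1}` and
`K·(hzBound + |c|) < O`, field `j < n` of `rowA … L[i] i` is `K·(hzInt L[i] L[j] − c·δ_ij)`.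
[cite: Harvey2009, §3.1] -/
theorem entry_rowA {p q : ℕ} {L : List ℕ} (hL : sectorListOK a b p q L = true) (TN TD UU : ℤ)
    {y : ℕ} (hy : 1 ≤ y) {RT : ℕ} (hRT : rankOK RT L 0 = true) {K : ℕ} {c : ℤ}
    (hK : K * (hzBound (a * b) TN TD UU + c.natAbs) < 2 ^ (y - 1)) (i j : Fin L.length) :
    PSD.Packed.entry y (rowA a b TN TD UU K c (2 ^ y) (2 ^ (y - 1)) (geomNat (2 ^ y) L.length) RT L[i] i) j =
      (K : ℤ) * (hzInt a b TN TD UU L[i] L[j] - if i = j then c else 0) := by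
  have hYO : (2 : ℕ) ^ y = 2 * 2 ^ (y - 1) := by
    rw [← pow_succ']; congr 1; omega
  have hYpos : 0 < (2 : ℕ) ^ y := Nat.two_pow_pos y
  -- the shifted scaled entries and their offset digits
  have hAbound : ∀ j : Fin L.length,
      |(K : ℤ) * (hzInt a b TN TD UU L[i] L[j] - if i = j then c else 0)| < ((2 ^ (y - 1) : ℕ) : ℤ) := by
    intro j
    have h1 := abs_hzInt_le (a := a) (b := b) TN TD UU L[i] L[j]
    have h2 : |hzInt a b TN TD UU L[i] L[j] - if i = j then c else 0| ≤ (hzBound (a * b) TN TD UU : ℤ) + c.natAbs := by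
      refine (abs_sub _ _).trans (add_le_add h1 ?_)
      split_ifs
      · exact le_of_eq (Int.natCast_natAbs c).symm
      · simp
    have hK' : ((K * (hzBound (a * b) TN TD UU + c.natAbs) : ℕ) : ℤ) < ((2 ^ (y - 1) : ℕ) : ℤ) := by
      exact_mod_cast hK
    calc |(K : ℤ) * (hzInt a b TN TD UU L[i] L[j] - if i = j then c else 0)|
        = (K : ℤ) * |hzInt a b TN TD UU L[i] L[j] - if i = j then c else 0| := by
            rw [abs_mul, abs_of_nonneg (Int.natCast_nonneg K)]
      _ ≤ (K : ℤ) * ((hzBound (a * b) TN TD UU : ℤ) + c.natAbs) := mul_le_mul_of_nonneg_left h2 (Int.natCast_nonneg K)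
      _ < ((2 ^ (y - 1) : ℕ) : ℤ) := by push_cast at hK' ⊢; linarith
  let A : Fin L.length → ℤ := fun j => (K : ℤ) * (hzInt a b TN TD UU L[i] L[j] - if i = j then c else 0)
  have hA : ∀ j, A j = (K : ℤ) * (hzInt a b TN TD UU L[i] L[j] - if i = j then c else 0) := fun j => rfl
  let d : ℕ → ℕ := fun j => if h : j < L.length then (A ⟨j, h⟩ + ((2 ^ (y - 1) : ℕ) : ℤ)).toNat else 0
  have hdcast' : ∀ (j : ℕ) (hj : j < L.length), ((d j : ℕ) : ℤ) = A ⟨j, hj⟩ + ((2 ^ (y - 1) : ℕ) : ℤ) := by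
    intro j hj
    show (((if h : j < L.length then (A ⟨j, h⟩ + ((2 ^ (y - 1) : ℕ) : ℤ)).toNat else 0 : ℕ) : ℕ) : ℤ) = _
    rw [dif_pos hj]
    have := hAbound ⟨j, hj⟩
    rw [← hA, abs_lt] at this
    rw [Int.toNat_of_nonneg (by linarith)]
  have hdcast : ∀ j : Fin L.length, ((d j : ℕ) : ℤ) = A j + ((2 ^ (y - 1) : ℕ) : ℤ) :=
    fun j => hdcast' j j.isLt
  have hdlt : ∀ j < L.length, d j < 2 ^ y := by
    intro j hj
    have := hAbound ⟨j, hj⟩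
    rw [← hA, abs_lt] at this
    have h2 : ((d j : ℕ) : ℤ) < ((2 ^ y : ℕ) : ℤ) := by
      rw [hdcast' j hj, hYO]
      push_cast at this ⊢
      linarith
    exact_mod_cast h2
  -- the packed row as the digit expansion
  have hsum : (K : ℤ) * rowH a b TN TD UU (2 ^ y) RT L[i] - (K : ℤ) * c * ((2 ^ y : ℕ) : ℤ) ^ (i : ℕ)
      + ((2 ^ (y - 1) : ℕ) : ℤ) * (geomNat (2 ^ y) L.length : ℤ) =
      ∑ j : Fin L.length, (A j + ((2 ^ (y - 1) : ℕ) : ℤ)) * ((2 ^ y : ℕ) : ℤ) ^ (j : ℕ) := by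
    rw [rowH_eq_sum hL TN TD UU hRT i, geomNat_eq, Finset.mul_sum, Nat.cast_sum, Finset.mul_sum,
      ← Fin.sum_univ_eq_sum_range (fun j => ((2 ^ (y - 1) : ℕ) : ℤ) * (((2 ^ y) ^ j : ℕ) : ℤ))]
    have hdiag : (K : ℤ) * c * ((2 ^ y : ℕ) : ℤ) ^ (i : ℕ) =
        ∑ j : Fin L.length, (K : ℤ) * (if i = j then c else 0) * ((2 ^ y : ℕ) : ℤ) ^ (j : ℕ) := by
      rw [Finset.sum_eq_single i (fun j _ hj => by rw [if_neg (Ne.symm hj)]; ring) (by simp)]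
      rw [if_pos rfl]
    rw [hdiag, ← Finset.sum_sub_distrib, ← Finset.sum_add_distrib]
    refine Finset.sum_congr rfl fun j _ => ?_
    rw [hA]; push_cast; ring
  have hnn : 0 ≤ (K : ℤ) * rowH a b TN TD UU (2 ^ y) RT L[i] - (K : ℤ) * c * ((2 ^ y : ℕ) : ℤ) ^ (i : ℕ)
      + ((2 ^ (y - 1) : ℕ) : ℤ) * (geomNat (2 ^ y) L.length : ℤ) := by
    rw [hsum]
    exact Finset.sum_nonneg fun j _ => mul_nonneg (by rw [← hdcast j]; exact Int.natCast_nonneg _)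
      (pow_nonneg (Int.natCast_nonneg _) _)
  have hrowN : rowA a b TN TD UU K c (2 ^ y) (2 ^ (y - 1)) (geomNat (2 ^ y) L.length) RT L[i] i =
      ∑ j ∈ range L.length, d j * (2 ^ y) ^ j := by
    zify
    rw [rowA, Int.toNat_of_nonneg (by exact_mod_cast hnn)]
    push_cast
    have hsum' := hsum
    push_cast at hsum'
    rw [hsum', ← Fin.sum_univ_eq_sum_range]
    refine Finset.sum_congr rfl fun j _ => ?_
    rw [hdcast j]
    push_cast
    ring
  -- read the field
  rw [PSD.Packed.entry, hrowN, Nat.shiftRight_eq_div_pow, show 2 ^ (y * (j : ℕ)) = (2 ^ y) ^ (j : ℕ) by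
    rw [← pow_mul], PSD.Packed.digit_of_expansion hYpos L.length d hdlt j, if_pos j.isLt, hdcast j, hA]
  ring

end Rows

end OccupationCode

end Literature.MathematicalPhysics.QuantumLattice
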